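import Summits.QuantumFields.YangMills.Theorems.UnitScaleTiltProp7ExactExpansion
import Summits.QuantumFields.YangMills.Theorems.UnitScaleTiltProp7Taylor3ExpChart
import Summits.QuantumFields.YangMills.Theorems.AlphaInputsT3ACv3PerturbedPlaquette
import HarnessLib

/-!
# Route `UnitScaleTilt`, crux K1 child «MinimiserStabilityRegPr» (stmt-QuantumFields-19200), skeleton v10, stub `stub_existenceMinimalOrbit`, route (α) (S3)(ii) GROWTH —
# T3W PART 1: THE EXACT QUADRATIC PART OF THE PLAQUETTE WORD AT A BACKGROUND, AND ITS THIRD-ORDER REMAINDER THROUGH THE EXPONENTIAL CHART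

Cell `ym3-torus`, width seat `ym-ust-19200-w4` (gen 2; OWNER 2026-08-28 02:30:53Z ∕ 02:33:35Z successor socket (σ-1) «(T3W) action-level TAYLOR3_W = exact quadratic part of the
plaquette word (extend `Prop7ExactExpansion.word4_sub_one_sub_lin_eq`)»; RULING (HESS_W) 02:40:40Z DEPMAP: GROWTH ⇐ CHART_W + TAYLOR3_W (this) + EL_W + HESS_W + (FV-u)).
THEOREMS ONLY (0 `def`, 0 `sorry`).  YM₃ on T³ is a ladder rung (R3), not the Clay problem; nothing here claims the stub, the crux, d = 4 or the mass gap.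

WHAT AND WHY.  The cell's exact plaquette identity (`Prop7ExactExpansion.quarter_hs_plaq_eq` ∕ `wilsonAction4_sub_eq_relPlaq`) organises `A(U) − A(W)` around the relative
plaquette variable `R_p = U(∂p)W(∂p)^*`, whose word in the transported fluctuations is `u₁u₂u₃^*u₄^*`; p1's `word4_sub_one_sub_lin_eq` isolates its LINEAR part with an
`O(|Y|²)` remainder.  The chart rows of route (α) ((141)–(142): Taylor to order three at the critical chart point) need one order more: the EXACT QUADRATIC part.  Along
the exponential chart `D ↦ e^{iD}W` (g0's `Prop7Taylor3ExpChart`: `Y(b) = e^{iD(b)} − 1 = iD(b) + ½(iD(b))² + O(|D|³)`) the word factors are `u_k = e^{Z_k}` (k = 1, 2) and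
`s_k = e^{−Z_k}` (k = 3, 4) with the TRANSPORTED letters `Z₁ = iD₁`, `Z₂ = V₁(iD₂)V₁^*`, `Z₃ = Q(iD₃)Q^*`, `Z₄ = P₀(iD₄)P₀^*` (`Q = V₁V₂V₃⁻¹`, `P₀ = V₁V₂V₃⁻¹V₄⁻¹`), so
  `R − 1 = (Z₁ + Z₂ − Z₃ − Z₄) + 𝒬 + O(|D|³)`,  `𝒬 = ½(Z₁² + Z₂² + Z₃² + Z₄²) + Z₁Z₂ − Z₁Z₃ − Z₁Z₄ − Z₂Z₃ − Z₂Z₄ + Z₃Z₄`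
(sanity: all `Z_k` equal ⇒ word `= 1`, linear part `= 0`, `𝒬 = 0`).  This file PROVES `‖R − 1 − ℒ − 𝒬‖ ≤ 4(Σ_k‖D_k‖)³` for `‖D_k‖ ≤ 1` (absolute constant), in three layers:
§1 the free-ring regrouping identity + the norm bookkeeping from abstract chart rows; §2 transport of the rows under unitary conjugation and `star`; §3 the rows of `e^{iD}` and
`(e^{iD})^* = e^{−iD}`; §4 ★ `norm_word_expChart_sub_lin_sub_quad_le` at special-unitary background links.  Part 2 (`UnitScaleTiltProp7Taylor3Action`) sums it into the
action-level TAYLOR3_W row `|A(e^{iD}W) − A(W) − ℓ_W(D) − q_W(D)| ≤ 4800·s·Σ_b‖D(b)‖²`.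

WHAT IS PROVED (ns `…Theorems.Prop7Taylor3Word`).  §1 `word4_sub_one_sub_lin_sub_quad_eq` (`noncomm_ring`), `remainder3_poly_le`, ★ `norm_word4_sub_one_sub_lin_sub_quad_le`,
`norm_quad_le` (`‖𝒬‖ ≤ ½(Σe_k)²`), `norm_lin_le`; §2 `conj_sub_conj`, `conj_sq`, `rows_conj`, `rows_conj_neg`, `star_coe_conj_sub_one`; §3 `star_exp_I_smul`,
`rows_exp`, `rows_star_exp`; §4 ★ `norm_word_expChart_sub_lin_sub_quad_le`.

HONEST SCOPE.  Matrix algebra and Banach-algebra Taylor estimates over the tree's letters; nothing of [Balaban1985Variational] is asserted; `--supports stmt-QuantumFields-19200`,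
count-neutral.  Not a claim about the continuum limit or the mass gap.

References: T. Bałaban, CMP 102 (1985) 277–309 [Balaban1985Variational] ((22)–(31) pp.281–283, (112) p.294, (141)–(142) p.299).
-/

set_option autoImplicit false

noncomputable section

open scoped BigOperators Matrix.Norms.L2Operator Matrix

namespace Summit.QuantumFields.YangMills.Theorems.Prop7Taylor3Word

open NormedSpace
open Literature.MathematicalPhysics.QuantumFieldTheory.Balaban1983to89
open Literature.MathematicalPhysics.QuantumFieldTheory.Balaban1983to89.T3ContinuumYM3Torus
open Literature.MathematicalPhysics.QuantumFieldTheory.Balaban1983to89.T3SectALandauChart (emb15)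
open Summit.QuantumFields.YangMills.Theorems.Prop7TPrint (expHerm coe_expHerm expHermField expHermField_apply)
open Summit.QuantumFields.YangMills.Theorems.Prop7Taylor3ExpChart (norm_I_smul norm_exp_sub_one_sub_sub_half_sq_le norm_exp_sub_one_le_two_mul)
open Summit.QuantumFields.YangMills.Theorems.Prop7CovariantCoercivity (plaqHol_eq_word coe_conj_sub_one plaq_mul_background)
open Summit.QuantumFields.YangMills.Theorems.PerturbedPlaquette (norm_conj_SU)

/-! ## §1 Algebra: the exact expansion of the four-factor word to second order, and the third-order remainder from the chart rows -/

section Algebra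

/-- **THE REGROUPING IDENTITY**: the four-factor word minus `1`, minus its linear part `Z₁ + Z₂ − Z₃ − Z₄`, minus its quadratic part
`(H₁ + H₂ + H₃ + H₄) + Z₁Z₂ − Z₁Z₃ − Z₁Z₄ − Z₂Z₃ − Z₂Z₄ + Z₃Z₄` (free letters `H_k` standing for `½Z_k²`), regrouped into third-order pieces: the four one-letter
Taylor remainders, six mixed pairs `(u − 1 − Z)(u′ − 1) + Z(u′ − 1 ∓ Z′)`, and the ordered triple and quadruple products. [folklore] -/
theorem word4_sub_one_sub_lin_sub_quad_eq {R : Type*} [Ring R] (u₁ u₂ s₃ s₄ Z₁ Z₂ Z₃ Z₄ H₁ H₂ H₃ H₄ : R) :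
    u₁ * u₂ * s₃ * s₄ - 1 - (Z₁ + Z₂ - Z₃ - Z₄) - ((H₁ + H₂ + H₃ + H₄) + Z₁ * Z₂ - Z₁ * Z₃ - Z₁ * Z₄ - Z₂ * Z₃ - Z₂ * Z₄ + Z₃ * Z₄)
      = ((u₁ - 1 - Z₁ - H₁) + (u₂ - 1 - Z₂ - H₂) + (s₃ - 1 + Z₃ - H₃) + (s₄ - 1 + Z₄ - H₄))
        + (((u₁ - 1 - Z₁) * (u₂ - 1) + Z₁ * (u₂ - 1 - Z₂))
          + ((u₁ - 1 - Z₁) * (s₃ - 1) + Z₁ * (s₃ - 1 + Z₃))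
          + ((u₁ - 1 - Z₁) * (s₄ - 1) + Z₁ * (s₄ - 1 + Z₄))
          + ((u₂ - 1 - Z₂) * (s₃ - 1) + Z₂ * (s₃ - 1 + Z₃))
          + ((u₂ - 1 - Z₂) * (s₄ - 1) + Z₂ * (s₄ - 1 + Z₄))
          + ((s₃ - 1 + Z₃) * (s₄ - 1) - Z₃ * (s₄ - 1 + Z₄)))
        + ((u₁ - 1) * (u₂ - 1) * (s₃ - 1) + (u₁ - 1) * (u₂ - 1) * (s₄ - 1) + (u₁ - 1) * (s₃ - 1) * (s₄ - 1)
            + (u₂ - 1) * (s₃ - 1) * (s₄ - 1) + (u₁ - 1) * (u₂ - 1) * (s₃ - 1) * (s₄ - 1)) := by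
  noncomm_ring

variable {𝔄 : Type*} [NormedRing 𝔄]

/-- `‖AB + ZC‖ ≤ ab + zc` from the four norm bounds. [folklore] -/
theorem norm_mul_add_mul_le {A B Z C : 𝔄} {a b z c : ℝ} (hA : ‖A‖ ≤ a) (hB : ‖B‖ ≤ b) (hZ : ‖Z‖ ≤ z) (hC : ‖C‖ ≤ c)
    (ha : 0 ≤ a) (hz : 0 ≤ z) : ‖A * B + Z * C‖ ≤ a * b + z * c :=
  (norm_add_le _ _).trans (add_le_add ((norm_mul_le _ _).trans (mul_le_mul hA hB (norm_nonneg _) ha))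
    ((norm_mul_le _ _).trans (mul_le_mul hZ hC (norm_nonneg _) hz)))

/-- `‖AB − ZC‖ ≤ ab + zc` from the four norm bounds. [folklore] -/
theorem norm_mul_sub_mul_le {A B Z C : 𝔄} {a b z c : ℝ} (hA : ‖A‖ ≤ a) (hB : ‖B‖ ≤ b) (hZ : ‖Z‖ ≤ z) (hC : ‖C‖ ≤ c)
    (ha : 0 ≤ a) (hz : 0 ≤ z) : ‖A * B - Z * C‖ ≤ a * b + z * c :=
  (norm_sub_le _ _).trans (add_le_add ((norm_mul_le _ _).trans (mul_le_mul hA hB (norm_nonneg _) ha))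
    ((norm_mul_le _ _).trans (mul_le_mul hZ hC (norm_nonneg _) hz)))

/-- `‖ABC‖ ≤ abc` from the three norm bounds. [folklore] -/
theorem norm_mul₃_le {A B C : 𝔄} {a b c : ℝ} (hA : ‖A‖ ≤ a) (hB : ‖B‖ ≤ b) (hC : ‖C‖ ≤ c) (ha : 0 ≤ a) (hb : 0 ≤ b) :
    ‖A * B * C‖ ≤ a * b * c :=
  (norm_mul_le _ _).trans (mul_le_mul ((norm_mul_le _ _).trans (mul_le_mul hA hB (norm_nonneg _) ha)) hC (norm_nonneg _)
    (mul_nonneg ha hb))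

/-- `‖a + b + c + d‖ ≤ ‖a‖ + ‖b‖ + ‖c‖ + ‖d‖`. [folklore] -/
theorem norm_add₄_le (a b c d : 𝔄) : ‖a + b + c + d‖ ≤ ‖a‖ + ‖b‖ + ‖c‖ + ‖d‖ :=
  (norm_add_le _ _).trans (add_le_add (norm_add₃_le) le_rfl)

/-- The polynomial bookkeeping on `[0, 1]⁴` behind the third-order remainder: one-letter cubes, mixed pairs, triples and the quadruple against `4(Σe_k)³`. [folklore] -/
theorem remainder3_poly_le {e₁ e₂ e₃ e₄ : ℝ} (h₀₁ : 0 ≤ e₁) (h₀₂ : 0 ≤ e₂) (h₀₃ : 0 ≤ e₃) (h₀₄ : 0 ≤ e₄) (h₁₄ : e₄ ≤ 1) :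
    (e₁ ^ 3 + e₂ ^ 3 + e₃ ^ 3 + e₄ ^ 3)
        + ((e₁ ^ 2 * (2 * e₂) + e₁ * e₂ ^ 2) + (e₁ ^ 2 * (2 * e₃) + e₁ * e₃ ^ 2) + (e₁ ^ 2 * (2 * e₄) + e₁ * e₄ ^ 2)
            + (e₂ ^ 2 * (2 * e₃) + e₂ * e₃ ^ 2) + (e₂ ^ 2 * (2 * e₄) + e₂ * e₄ ^ 2) + (e₃ ^ 2 * (2 * e₄) + e₃ * e₄ ^ 2))
        + (2 * e₁ * (2 * e₂) * (2 * e₃) + 2 * e₁ * (2 * e₂) * (2 * e₄) + 2 * e₁ * (2 * e₃) * (2 * e₄) + 2 * e₂ * (2 * e₃) * (2 * e₄)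
            + 2 * e₁ * (2 * e₂) * (2 * e₃) * (2 * e₄))
      ≤ 4 * (e₁ + e₂ + e₃ + e₄) ^ 3 := by
  have m₁₂₃ : 0 ≤ e₁ * e₂ * e₃ := by positivity
  have hq : e₁ * e₂ * e₃ * e₄ ≤ e₁ * e₂ * e₃ := by nlinarith
  nlinarith [mul_nonneg (mul_nonneg h₀₁ h₀₂) h₀₄, mul_nonneg (mul_nonneg h₀₁ h₀₃) h₀₄, mul_nonneg (mul_nonneg h₀₂ h₀₃) h₀₄,
    mul_nonneg (pow_nonneg h₀₁ 2) h₀₂, mul_nonneg (pow_nonneg h₀₁ 2) h₀₃, mul_nonneg (pow_nonneg h₀₁ 2) h₀₄,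
    mul_nonneg (pow_nonneg h₀₂ 2) h₀₁, mul_nonneg (pow_nonneg h₀₂ 2) h₀₃, mul_nonneg (pow_nonneg h₀₂ 2) h₀₄,
    mul_nonneg (pow_nonneg h₀₃ 2) h₀₁, mul_nonneg (pow_nonneg h₀₃ 2) h₀₂, mul_nonneg (pow_nonneg h₀₃ 2) h₀₄,
    mul_nonneg (pow_nonneg h₀₄ 2) h₀₁, mul_nonneg (pow_nonneg h₀₄ 2) h₀₂, mul_nonneg (pow_nonneg h₀₄ 2) h₀₃,
    pow_nonneg h₀₁ 3, pow_nonneg h₀₂ 3, pow_nonneg h₀₃ 3, pow_nonneg h₀₄ 3]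

/-- **THE THIRD-ORDER REMAINDER OF THE FOUR-FACTOR WORD FROM THE CHART ROWS** (abstract, any normed `ℂ`-algebra): if the word factors `u₁, u₂` and `s₃, s₄` carry
letters `Z_k` with the rows `‖u_k − 1 − Z_k − ½Z_k²‖ ≤ e_k³`, `‖u_k − 1 − Z_k‖ ≤ e_k²`, `‖u_k − 1‖ ≤ 2e_k`, `‖Z_k‖ ≤ e_k` (`k = 1, 2`) and
`‖s_k − 1 + Z_k − ½Z_k²‖ ≤ e_k³`, `‖s_k − 1 + Z_k‖ ≤ e_k²`, `‖s_k − 1‖ ≤ 2e_k`, `‖Z_k‖ ≤ e_k` (`k = 3, 4`), `0 ≤ e_k ≤ 1`, then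
`‖u₁u₂s₃s₄ − 1 − (Z₁ + Z₂ − Z₃ − Z₄) − 𝒬‖ ≤ 4(e₁ + e₂ + e₃ + e₄)³` with the EXACT QUADRATIC PART
`𝒬 = ½(Z₁² + Z₂² + Z₃² + Z₄²) + Z₁Z₂ − Z₁Z₃ − Z₁Z₄ − Z₂Z₃ − Z₂Z₄ + Z₃Z₄`. [cite: Balaban1985Variational, (22)-(26) pp.281-282, (141)-(142) p.299] -/
theorem norm_word4_sub_one_sub_lin_sub_quad_le [NormedAlgebra ℂ 𝔄] (u₁ u₂ s₃ s₄ Z₁ Z₂ Z₃ Z₄ : 𝔄) {e₁ e₂ e₃ e₄ : ℝ}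
    (h₀₁ : 0 ≤ e₁) (h₀₂ : 0 ≤ e₂) (h₀₃ : 0 ≤ e₃) (h₀₄ : 0 ≤ e₄) (h₁₄ : e₄ ≤ 1)
    (n₁ : ‖Z₁‖ ≤ e₁) (n₂ : ‖Z₂‖ ≤ e₂) (n₃ : ‖Z₃‖ ≤ e₃)
    (a₁ : ‖u₁ - 1‖ ≤ 2 * e₁) (a₂ : ‖u₂ - 1‖ ≤ 2 * e₂) (a₃ : ‖s₃ - 1‖ ≤ 2 * e₃) (a₄ : ‖s₄ - 1‖ ≤ 2 * e₄)
    (b₁ : ‖u₁ - 1 - Z₁‖ ≤ e₁ ^ 2) (b₂ : ‖u₂ - 1 - Z₂‖ ≤ e₂ ^ 2) (b₃ : ‖s₃ - 1 + Z₃‖ ≤ e₃ ^ 2) (b₄ : ‖s₄ - 1 + Z₄‖ ≤ e₄ ^ 2)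
    (c₁ : ‖u₁ - 1 - Z₁ - (2 : ℂ)⁻¹ • Z₁ ^ 2‖ ≤ e₁ ^ 3) (c₂ : ‖u₂ - 1 - Z₂ - (2 : ℂ)⁻¹ • Z₂ ^ 2‖ ≤ e₂ ^ 3)
    (c₃ : ‖s₃ - 1 + Z₃ - (2 : ℂ)⁻¹ • Z₃ ^ 2‖ ≤ e₃ ^ 3) (c₄ : ‖s₄ - 1 + Z₄ - (2 : ℂ)⁻¹ • Z₄ ^ 2‖ ≤ e₄ ^ 3) :
    ‖u₁ * u₂ * s₃ * s₄ - 1 - (Z₁ + Z₂ - Z₃ - Z₄)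
        - ((2 : ℂ)⁻¹ • (Z₁ ^ 2 + Z₂ ^ 2 + Z₃ ^ 2 + Z₄ ^ 2) + Z₁ * Z₂ - Z₁ * Z₃ - Z₁ * Z₄ - Z₂ * Z₃ - Z₂ * Z₄ + Z₃ * Z₄)‖
      ≤ 4 * (e₁ + e₂ + e₃ + e₄) ^ 3 := by
  have hH : (2 : ℂ)⁻¹ • (Z₁ ^ 2 + Z₂ ^ 2 + Z₃ ^ 2 + Z₄ ^ 2)
      = (2 : ℂ)⁻¹ • Z₁ ^ 2 + (2 : ℂ)⁻¹ • Z₂ ^ 2 + (2 : ℂ)⁻¹ • Z₃ ^ 2 + (2 : ℂ)⁻¹ • Z₄ ^ 2 := by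
    simp only [smul_add]
  rw [hH, word4_sub_one_sub_lin_sub_quad_eq]
  -- the linear group
  have tL : ‖(u₁ - 1 - Z₁ - (2 : ℂ)⁻¹ • Z₁ ^ 2) + (u₂ - 1 - Z₂ - (2 : ℂ)⁻¹ • Z₂ ^ 2) + (s₃ - 1 + Z₃ - (2 : ℂ)⁻¹ • Z₃ ^ 2)
        + (s₄ - 1 + Z₄ - (2 : ℂ)⁻¹ • Z₄ ^ 2)‖ ≤ e₁ ^ 3 + e₂ ^ 3 + e₃ ^ 3 + e₄ ^ 3 :=
    (norm_add₄_le _ _ _ _).trans (add_le_add (add_le_add (add_le_add c₁ c₂) c₃) c₄)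
  -- the six pairs
  have h2sq : ∀ {e : ℝ}, 0 ≤ e → 0 ≤ e ^ 2 := fun he => pow_nonneg he 2
  have p₁₂ := norm_mul_add_mul_le b₁ a₂ n₁ b₂ (h2sq h₀₁) h₀₁
  have p₁₃ := norm_mul_add_mul_le b₁ a₃ n₁ b₃ (h2sq h₀₁) h₀₁
  have p₁₄ := norm_mul_add_mul_le b₁ a₄ n₁ b₄ (h2sq h₀₁) h₀₁
  have p₂₃ := norm_mul_add_mul_le b₂ a₃ n₂ b₃ (h2sq h₀₂) h₀₂
  have p₂₄ := norm_mul_add_mul_le b₂ a₄ n₂ b₄ (h2sq h₀₂) h₀₂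
  have p₃₄ := norm_mul_sub_mul_le b₃ a₄ n₃ b₄ (h2sq h₀₃) h₀₃
  have tP : ‖((u₁ - 1 - Z₁) * (u₂ - 1) + Z₁ * (u₂ - 1 - Z₂))
          + ((u₁ - 1 - Z₁) * (s₃ - 1) + Z₁ * (s₃ - 1 + Z₃))
          + ((u₁ - 1 - Z₁) * (s₄ - 1) + Z₁ * (s₄ - 1 + Z₄))
          + ((u₂ - 1 - Z₂) * (s₃ - 1) + Z₂ * (s₃ - 1 + Z₃))
          + ((u₂ - 1 - Z₂) * (s₄ - 1) + Z₂ * (s₄ - 1 + Z₄))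
          + ((s₃ - 1 + Z₃) * (s₄ - 1) - Z₃ * (s₄ - 1 + Z₄))‖
      ≤ (e₁ ^ 2 * (2 * e₂) + e₁ * e₂ ^ 2) + (e₁ ^ 2 * (2 * e₃) + e₁ * e₃ ^ 2) + (e₁ ^ 2 * (2 * e₄) + e₁ * e₄ ^ 2)
          + (e₂ ^ 2 * (2 * e₃) + e₂ * e₃ ^ 2) + (e₂ ^ 2 * (2 * e₄) + e₂ * e₄ ^ 2) + (e₃ ^ 2 * (2 * e₄) + e₃ * e₄ ^ 2) := by
    refine (norm_add_le _ _).trans (add_le_add ?_ p₃₄)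
    refine (norm_add_le _ _).trans (add_le_add ?_ p₂₄)
    refine (norm_add_le _ _).trans (add_le_add ?_ p₂₃)
    refine (norm_add_le _ _).trans (add_le_add ?_ p₁₄)
    exact (norm_add_le _ _).trans (add_le_add p₁₂ p₁₃)
  -- the triples and the quadruple
  have q₁₂₃ := norm_mul₃_le a₁ a₂ a₃ (by positivity) (by positivity)
  have q₁₂₄ := norm_mul₃_le a₁ a₂ a₄ (by positivity) (by positivity)
  have q₁₃₄ := norm_mul₃_le a₁ a₃ a₄ (by positivity) (by positivity)
  have q₂₃₄ := norm_mul₃_le a₂ a₃ a₄ (by positivity) (by positivity)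
  have q₁₂₃₄ : ‖(u₁ - 1) * (u₂ - 1) * (s₃ - 1) * (s₄ - 1)‖ ≤ 2 * e₁ * (2 * e₂) * (2 * e₃) * (2 * e₄) :=
    (norm_mul_le _ _).trans (mul_le_mul q₁₂₃ a₄ (norm_nonneg _) (by positivity))
  have tT : ‖(u₁ - 1) * (u₂ - 1) * (s₃ - 1) + (u₁ - 1) * (u₂ - 1) * (s₄ - 1) + (u₁ - 1) * (s₃ - 1) * (s₄ - 1)
          + (u₂ - 1) * (s₃ - 1) * (s₄ - 1) + (u₁ - 1) * (u₂ - 1) * (s₃ - 1) * (s₄ - 1)‖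
      ≤ 2 * e₁ * (2 * e₂) * (2 * e₃) + 2 * e₁ * (2 * e₂) * (2 * e₄) + 2 * e₁ * (2 * e₃) * (2 * e₄) + 2 * e₂ * (2 * e₃) * (2 * e₄)
          + 2 * e₁ * (2 * e₂) * (2 * e₃) * (2 * e₄) := by
    refine (norm_add_le _ _).trans (add_le_add ?_ q₁₂₃₄)
    exact (norm_add₄_le _ _ _ _).trans (add_le_add (add_le_add (add_le_add q₁₂₃ q₁₂₄) q₁₃₄) q₂₃₄)
  exact (norm_add₃_le).trans ((add_le_add (add_le_add tL tP) tT).trans (remainder3_poly_le h₀₁ h₀₂ h₀₃ h₀₄ h₁₄))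

/-- **THE SIZE OF THE QUADRATIC PART**: `‖𝒬‖ ≤ ½(e₁ + e₂ + e₃ + e₄)²`. [folklore] -/
theorem norm_quad_le [NormedAlgebra ℂ 𝔄] (Z₁ Z₂ Z₃ Z₄ : 𝔄) {e₁ e₂ e₃ e₄ : ℝ}
    (h₀₁ : 0 ≤ e₁) (h₀₂ : 0 ≤ e₂) (h₀₃ : 0 ≤ e₃) (h₀₄ : 0 ≤ e₄)
    (n₁ : ‖Z₁‖ ≤ e₁) (n₂ : ‖Z₂‖ ≤ e₂) (n₃ : ‖Z₃‖ ≤ e₃) (n₄ : ‖Z₄‖ ≤ e₄) :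
    ‖(2 : ℂ)⁻¹ • (Z₁ ^ 2 + Z₂ ^ 2 + Z₃ ^ 2 + Z₄ ^ 2) + Z₁ * Z₂ - Z₁ * Z₃ - Z₁ * Z₄ - Z₂ * Z₃ - Z₂ * Z₄ + Z₃ * Z₄‖
      ≤ (1 / 2) * (e₁ + e₂ + e₃ + e₄) ^ 2 := by
  have hsq : ∀ {Z : 𝔄} {e : ℝ}, ‖Z‖ ≤ e → 0 ≤ e → ‖Z ^ 2‖ ≤ e ^ 2 := fun hZ he =>
    (norm_pow_le' _ (by norm_num)).trans (pow_le_pow_left₀ (norm_nonneg _) hZ 2)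
  have hS : ‖(2 : ℂ)⁻¹ • (Z₁ ^ 2 + Z₂ ^ 2 + Z₃ ^ 2 + Z₄ ^ 2)‖ ≤ (1 / 2) * (e₁ ^ 2 + e₂ ^ 2 + e₃ ^ 2 + e₄ ^ 2) := by
    rw [norm_smul, norm_inv, Complex.norm_ofNat]
    have := (norm_add₄_le (Z₁ ^ 2) (Z₂ ^ 2) (Z₃ ^ 2) (Z₄ ^ 2)).trans
      (add_le_add (add_le_add (add_le_add (hsq n₁ h₀₁) (hsq n₂ h₀₂)) (hsq n₃ h₀₃)) (hsq n₄ h₀₄))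
    have h2 : (2 : ℝ)⁻¹ = 1 / 2 := by norm_num
    rw [h2]
    exact mul_le_mul_of_nonneg_left this (by norm_num)
  have hm : ∀ {Z Z' : 𝔄} {e e' : ℝ}, ‖Z‖ ≤ e → ‖Z'‖ ≤ e' → 0 ≤ e → ‖Z * Z'‖ ≤ e * e' := fun hZ hZ' he =>
    (norm_mul_le _ _).trans (mul_le_mul hZ hZ' (norm_nonneg _) he)
  have t : ‖(2 : ℂ)⁻¹ • (Z₁ ^ 2 + Z₂ ^ 2 + Z₃ ^ 2 + Z₄ ^ 2) + Z₁ * Z₂ - Z₁ * Z₃ - Z₁ * Z₄ - Z₂ * Z₃ - Z₂ * Z₄ + Z₃ * Z₄‖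
      ≤ (1 / 2) * (e₁ ^ 2 + e₂ ^ 2 + e₃ ^ 2 + e₄ ^ 2) + e₁ * e₂ + e₁ * e₃ + e₁ * e₄ + e₂ * e₃ + e₂ * e₄ + e₃ * e₄ := by
    refine (norm_add_le _ _).trans (add_le_add ?_ (hm n₃ n₄ h₀₃))
    refine (norm_sub_le _ _).trans (add_le_add ?_ (hm n₂ n₄ h₀₂))
    refine (norm_sub_le _ _).trans (add_le_add ?_ (hm n₂ n₃ h₀₂))
    refine (norm_sub_le _ _).trans (add_le_add ?_ (hm n₁ n₄ h₀₁))
    refine (norm_sub_le _ _).trans (add_le_add ?_ (hm n₁ n₃ h₀₁))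
    exact (norm_add_le _ _).trans (add_le_add hS (hm n₁ n₂ h₀₁))
  refine t.trans ?_
  nlinarith [mul_nonneg h₀₁ h₀₂, mul_nonneg h₀₁ h₀₃, mul_nonneg h₀₁ h₀₄, mul_nonneg h₀₂ h₀₃, mul_nonneg h₀₂ h₀₄, mul_nonneg h₀₃ h₀₄]

/-- **THE SIZE OF THE LINEAR PART**: `‖Z₁ + Z₂ − Z₃ − Z₄‖ ≤ e₁ + e₂ + e₃ + e₄`. [folklore] -/
theorem norm_lin_le (Z₁ Z₂ Z₃ Z₄ : 𝔄) {e₁ e₂ e₃ e₄ : ℝ}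
    (n₁ : ‖Z₁‖ ≤ e₁) (n₂ : ‖Z₂‖ ≤ e₂) (n₃ : ‖Z₃‖ ≤ e₃) (n₄ : ‖Z₄‖ ≤ e₄) :
    ‖Z₁ + Z₂ - Z₃ - Z₄‖ ≤ e₁ + e₂ + e₃ + e₄ :=
  (norm_sub_le _ _).trans (add_le_add ((norm_sub_le _ _).trans (add_le_add ((norm_add_le _ _).trans (add_le_add n₁ n₂)) n₃)) n₄)

end Algebra

/-! ## §2 The chart rows under transport along the plaquette: unitary conjugation and `star` -/

section Transport

variable {n : Type*} [Fintype n] [DecidableEq n]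

/-- `gAg^* − gXg^* = g(A − X)g^*`, `gAg^* + gXg^* = g(A + X)g^*`. [folklore] -/
theorem conj_sub_conj (v w A X : Matrix n n ℂ) : v * A * w - v * X * w = v * (A - X) * w ∧ v * A * w + v * X * w = v * (A + X) * w := by
  constructor <;> noncomm_ring

/-- `(gXg^*)² = gX²g^*` for special unitary `g`. [folklore] -/
theorem conj_sq (g : Matrix.specialUnitaryGroup n ℂ) (X : Matrix n n ℂ) :
    ((g : Matrix n n ℂ) * X * star (g : Matrix n n ℂ)) ^ 2 = (g : Matrix n n ℂ) * X ^ 2 * star (g : Matrix n n ℂ) := by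
  have hg : star (g : Matrix n n ℂ) * (g : Matrix n n ℂ) = 1 := Matrix.mem_unitaryGroup_iff'.mp g.2.1
  calc ((g : Matrix n n ℂ) * X * star (g : Matrix n n ℂ)) ^ 2
        = (g : Matrix n n ℂ) * X * (star (g : Matrix n n ℂ) * (g : Matrix n n ℂ)) * X * star (g : Matrix n n ℂ) := by rw [sq]; noncomm_ring
    _ = (g : Matrix n n ℂ) * X ^ 2 * star (g : Matrix n n ℂ) := by rw [hg, sq]; noncomm_ring

/-- **TRANSPORTED ROWS**: the three chart rows of a letter `A` against `X` (`‖A‖ ≤ a`, `‖A − X‖ ≤ b`, `‖A − X − ½X²‖ ≤ c`) survive conjugation by a special unitary `g`,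
with the transported letter `gXg^*`. [folklore] -/
theorem rows_conj (g : Matrix.specialUnitaryGroup n ℂ) (A X : Matrix n n ℂ) {a b c : ℝ}
    (ha : ‖A‖ ≤ a) (hb : ‖A - X‖ ≤ b) (hc : ‖A - X - (2 : ℂ)⁻¹ • X ^ 2‖ ≤ c) :
    ‖(g : Matrix n n ℂ) * A * star (g : Matrix n n ℂ)‖ ≤ a
      ∧ ‖(g : Matrix n n ℂ) * A * star (g : Matrix n n ℂ) - (g : Matrix n n ℂ) * X * star (g : Matrix n n ℂ)‖ ≤ b
      ∧ ‖(g : Matrix n n ℂ) * A * star (g : Matrix n n ℂ) - (g : Matrix n n ℂ) * X * star (g : Matrix n n ℂ)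
          - (2 : ℂ)⁻¹ • ((g : Matrix n n ℂ) * X * star (g : Matrix n n ℂ)) ^ 2‖ ≤ c := by
  refine ⟨by rwa [norm_conj_SU], by rwa [(conj_sub_conj _ _ A X).1, norm_conj_SU], ?_⟩
  have e : (g : Matrix n n ℂ) * A * star (g : Matrix n n ℂ) - (g : Matrix n n ℂ) * X * star (g : Matrix n n ℂ)
        - (2 : ℂ)⁻¹ • ((g : Matrix n n ℂ) * X * star (g : Matrix n n ℂ)) ^ 2
      = (g : Matrix n n ℂ) * (A - X - (2 : ℂ)⁻¹ • X ^ 2) * star (g : Matrix n n ℂ) := by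
    rw [conj_sq, (conj_sub_conj _ _ A X).1, ← Matrix.smul_mul, ← Matrix.mul_smul, (conj_sub_conj _ _ (A - X) _).1]
  rw [e, norm_conj_SU]; exact hc

/-- The same with the OPPOSITE sign of the letter (`‖A + X‖ ≤ b`, `‖A + X − ½X²‖ ≤ c`), for the inverted factors of the word. [folklore] -/
theorem rows_conj_neg (g : Matrix.specialUnitaryGroup n ℂ) (A X : Matrix n n ℂ) {a b c : ℝ}
    (ha : ‖A‖ ≤ a) (hb : ‖A + X‖ ≤ b) (hc : ‖A + X - (2 : ℂ)⁻¹ • X ^ 2‖ ≤ c) :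
    ‖(g : Matrix n n ℂ) * A * star (g : Matrix n n ℂ)‖ ≤ a
      ∧ ‖(g : Matrix n n ℂ) * A * star (g : Matrix n n ℂ) + (g : Matrix n n ℂ) * X * star (g : Matrix n n ℂ)‖ ≤ b
      ∧ ‖(g : Matrix n n ℂ) * A * star (g : Matrix n n ℂ) + (g : Matrix n n ℂ) * X * star (g : Matrix n n ℂ)
          - (2 : ℂ)⁻¹ • ((g : Matrix n n ℂ) * X * star (g : Matrix n n ℂ)) ^ 2‖ ≤ c := by
  refine ⟨by rwa [norm_conj_SU], by rwa [(conj_sub_conj _ _ A X).2, norm_conj_SU], ?_⟩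
  have e : (g : Matrix n n ℂ) * A * star (g : Matrix n n ℂ) + (g : Matrix n n ℂ) * X * star (g : Matrix n n ℂ)
        - (2 : ℂ)⁻¹ • ((g : Matrix n n ℂ) * X * star (g : Matrix n n ℂ)) ^ 2
      = (g : Matrix n n ℂ) * (A + X - (2 : ℂ)⁻¹ • X ^ 2) * star (g : Matrix n n ℂ) := by
    rw [conj_sq, (conj_sub_conj _ _ A X).2, ← Matrix.smul_mul, ← Matrix.mul_smul, (conj_sub_conj _ _ (A + X) _).1]
  rw [e, norm_conj_SU]; exact hc

/-- `g W g⁻¹ − 1` and its adjoint, read in `M_n(ℂ)`: `star((gWg⁻¹) − 1) = g(W^* − 1)g^*`. [folklore] -/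
theorem star_coe_conj_sub_one (g W : Matrix.specialUnitaryGroup n ℂ) :
    star (((g * W * g⁻¹ : Matrix.specialUnitaryGroup n ℂ) : Matrix n n ℂ) - 1)
      = (g : Matrix n n ℂ) * (star (W : Matrix n n ℂ) - 1) * star (g : Matrix n n ℂ) := by
  rw [coe_conj_sub_one, star_mul, star_mul, star_star, star_sub, star_one, ← mul_assoc]

end Transport

/-! ## §3 The chart rows of `e^{iD}` and of its adjoint `e^{−iD}` (from `Prop7Taylor3ExpChart` §1) -/

section Chart

/-- `(e^{iD})^* = e^{−iD}` for Hermitian `D`. [folklore] -/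
theorem star_exp_I_smul {D : Matrix (Fin 2) (Fin 2) ℂ} (hD : D.IsHermitian) :
    star (exp (Complex.I • D)) = exp (-(Complex.I • D)) := by
  rw [star_exp, star_smul, Complex.star_def, Complex.conj_I, Matrix.star_eq_conjTranspose, hD.eq, neg_smul]

/-- **THE THREE CHART ROWS OF `e^{x} − 1` AGAINST `x`** (`‖x‖ ≤ 1`): `‖e^x − 1‖ ≤ 2‖x‖`, `‖e^x − 1 − x‖ ≤ ‖x‖²`, `‖e^x − 1 − x − ½x²‖ ≤ ‖x‖³`.
[cite: Balaban1985Variational, (112) p.294, (22) p.281] -/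
theorem rows_exp (x : Matrix (Fin 2) (Fin 2) ℂ) (hx : ‖x‖ ≤ 1) :
    ‖exp x - 1‖ ≤ 2 * ‖x‖ ∧ ‖exp x - 1 - x‖ ≤ ‖x‖ ^ 2 ∧ ‖exp x - 1 - x - (2 : ℂ)⁻¹ • x ^ 2‖ ≤ ‖x‖ ^ 3 :=
  ⟨norm_exp_sub_one_le_two_mul hx, Literature.Analysis.Complex.norm_exp_sub_one_sub_le hx, norm_exp_sub_one_sub_sub_half_sq_le hx⟩

/-- **THE ROWS OF THE ADJOINT FACTOR**: for Hermitian `D` with `‖D‖ ≤ 1` and `A = (e^{iD})^* − 1`: `‖A‖ ≤ 2‖D‖`, `‖A + iD‖ ≤ ‖D‖²`, `‖A + iD − ½(iD)²‖ ≤ ‖D‖³`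
(the letter of an inverted word factor is `−iD`). [cite: Balaban1985Variational, (112) p.294, (22)-(26) pp.281-282] -/
theorem rows_star_exp {D : Matrix (Fin 2) (Fin 2) ℂ} (hD : D.IsHermitian) (h1 : ‖D‖ ≤ 1) :
    ‖star (exp (Complex.I • D)) - 1‖ ≤ 2 * ‖D‖ ∧ ‖star (exp (Complex.I • D)) - 1 + Complex.I • D‖ ≤ ‖D‖ ^ 2
      ∧ ‖star (exp (Complex.I • D)) - 1 + Complex.I • D - (2 : ℂ)⁻¹ • (Complex.I • D) ^ 2‖ ≤ ‖D‖ ^ 3 := by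
  have hx : ‖-(Complex.I • D)‖ = ‖D‖ := by rw [norm_neg, norm_I_smul]
  obtain ⟨r1, r2, r3⟩ := rows_exp (-(Complex.I • D)) (by rw [hx]; exact h1)
  rw [hx] at r1 r2 r3
  rw [star_exp_I_smul hD]
  refine ⟨r1, by rwa [sub_neg_eq_add] at r2, ?_⟩
  rwa [sub_neg_eq_add, neg_sq] at r3

end Chart

/-! ## §4 The plaquette word of `e^{iD}W` against the background plaquette: the exact linear and quadratic parts in transported letters -/

section Word

/-- **[Balaban1985Variational] SECT. B AT A BACKGROUND TO SECOND ORDER, EXACTLY**: for background links `V_i ∈ SU(2)` (`Q = V₁V₂V₃⁻¹`, `P₀ = V₁V₂V₃⁻¹V₄⁻¹`) and chart letters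
`D_i` Hermitian traceless with `‖D_i‖ ≤ 1`, the relative plaquette variable of `(e^{iD₁}V₁)(e^{iD₂}V₂)(e^{iD₃}V₃)⁻¹(e^{iD₄}V₄)⁻¹` against `P₀` satisfies
`‖R − 1 − ℒ − 𝒬‖ ≤ 4(Σ‖D_i‖)³` with the transported letters `Z₁ = iD₁`, `Z₂ = V₁(iD₂)V₁^*`, `Z₃ = Q(iD₃)Q^*`, `Z₄ = P₀(iD₄)P₀^*`, the linear part
`ℒ = Z₁ + Z₂ − Z₃ − Z₄` and the EXACT quadratic part `𝒬 = ½ΣZ_k² + Z₁Z₂ − Z₁Z₃ − Z₁Z₄ − Z₂Z₃ − Z₂Z₄ + Z₃Z₄`. [cite: Balaban1985Variational, (22)-(26) pp.281-282, (141)-(142) p.299] -/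
theorem norm_word_expChart_sub_lin_sub_quad_le (V₁ V₂ V₃ V₄ : Matrix.specialUnitaryGroup (Fin 2) ℂ) (D₁ D₂ D₃ D₄ : Matrix (Fin 2) (Fin 2) ℂ)
    (hD₁ : D₁.IsHermitian ∧ D₁.trace = 0) (hD₂ : D₂.IsHermitian ∧ D₂.trace = 0) (hD₃ : D₃.IsHermitian ∧ D₃.trace = 0)
    (hD₄ : D₄.IsHermitian ∧ D₄.trace = 0) (h₁ : ‖D₁‖ ≤ 1) (h₂ : ‖D₂‖ ≤ 1) (h₃ : ‖D₃‖ ≤ 1) (h₄ : ‖D₄‖ ≤ 1) :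
    ‖(((expHerm D₁ * V₁) * (expHerm D₂ * V₂) * (expHerm D₃ * V₃)⁻¹ * (expHerm D₄ * V₄)⁻¹ : Matrix.specialUnitaryGroup (Fin 2) ℂ) : Matrix (Fin 2) (Fin 2) ℂ) * star ((V₁ * V₂ * V₃⁻¹ * V₄⁻¹ : Matrix.specialUnitaryGroup (Fin 2) ℂ) : Matrix (Fin 2) (Fin 2) ℂ) - 1
        - (Complex.I • D₁ + (V₁ : Matrix (Fin 2) (Fin 2) ℂ) * (Complex.I • D₂) * star (V₁ : Matrix (Fin 2) (Fin 2) ℂ)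
            - ((V₁ * V₂ * V₃⁻¹ : Matrix.specialUnitaryGroup (Fin 2) ℂ) : Matrix (Fin 2) (Fin 2) ℂ) * (Complex.I • D₃) * star ((V₁ * V₂ * V₃⁻¹ : Matrix.specialUnitaryGroup (Fin 2) ℂ) : Matrix (Fin 2) (Fin 2) ℂ)
            - ((V₁ * V₂ * V₃⁻¹ * V₄⁻¹ : Matrix.specialUnitaryGroup (Fin 2) ℂ) : Matrix (Fin 2) (Fin 2) ℂ) * (Complex.I • D₄) * star ((V₁ * V₂ * V₃⁻¹ * V₄⁻¹ : Matrix.specialUnitaryGroup (Fin 2) ℂ) : Matrix (Fin 2) (Fin 2) ℂ))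
        - ((2 : ℂ)⁻¹ • ((Complex.I • D₁) ^ 2 + ((V₁ : Matrix (Fin 2) (Fin 2) ℂ) * (Complex.I • D₂) * star (V₁ : Matrix (Fin 2) (Fin 2) ℂ)) ^ 2
              + (((V₁ * V₂ * V₃⁻¹ : Matrix.specialUnitaryGroup (Fin 2) ℂ) : Matrix (Fin 2) (Fin 2) ℂ) * (Complex.I • D₃) * star ((V₁ * V₂ * V₃⁻¹ : Matrix.specialUnitaryGroup (Fin 2) ℂ) : Matrix (Fin 2) (Fin 2) ℂ)) ^ 2
              + (((V₁ * V₂ * V₃⁻¹ * V₄⁻¹ : Matrix.specialUnitaryGroup (Fin 2) ℂ) : Matrix (Fin 2) (Fin 2) ℂ) * (Complex.I • D₄) * star ((V₁ * V₂ * V₃⁻¹ * V₄⁻¹ : Matrix.specialUnitaryGroup (Fin 2) ℂ) : Matrix (Fin 2) (Fin 2) ℂ)) ^ 2)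
            + (Complex.I • D₁) * ((V₁ : Matrix (Fin 2) (Fin 2) ℂ) * (Complex.I • D₂) * star (V₁ : Matrix (Fin 2) (Fin 2) ℂ))
            - (Complex.I • D₁) * (((V₁ * V₂ * V₃⁻¹ : Matrix.specialUnitaryGroup (Fin 2) ℂ) : Matrix (Fin 2) (Fin 2) ℂ) * (Complex.I • D₃) * star ((V₁ * V₂ * V₃⁻¹ : Matrix.specialUnitaryGroup (Fin 2) ℂ) : Matrix (Fin 2) (Fin 2) ℂ))
            - (Complex.I • D₁) * (((V₁ * V₂ * V₃⁻¹ * V₄⁻¹ : Matrix.specialUnitaryGroup (Fin 2) ℂ) : Matrix (Fin 2) (Fin 2) ℂ) * (Complex.I • D₄) * star ((V₁ * V₂ * V₃⁻¹ * V₄⁻¹ : Matrix.specialUnitaryGroup (Fin 2) ℂ) : Matrix (Fin 2) (Fin 2) ℂ))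
            - ((V₁ : Matrix (Fin 2) (Fin 2) ℂ) * (Complex.I • D₂) * star (V₁ : Matrix (Fin 2) (Fin 2) ℂ))
                * (((V₁ * V₂ * V₃⁻¹ : Matrix.specialUnitaryGroup (Fin 2) ℂ) : Matrix (Fin 2) (Fin 2) ℂ) * (Complex.I • D₃) * star ((V₁ * V₂ * V₃⁻¹ : Matrix.specialUnitaryGroup (Fin 2) ℂ) : Matrix (Fin 2) (Fin 2) ℂ))
            - ((V₁ : Matrix (Fin 2) (Fin 2) ℂ) * (Complex.I • D₂) * star (V₁ : Matrix (Fin 2) (Fin 2) ℂ))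
                * (((V₁ * V₂ * V₃⁻¹ * V₄⁻¹ : Matrix.specialUnitaryGroup (Fin 2) ℂ) : Matrix (Fin 2) (Fin 2) ℂ) * (Complex.I • D₄) * star ((V₁ * V₂ * V₃⁻¹ * V₄⁻¹ : Matrix.specialUnitaryGroup (Fin 2) ℂ) : Matrix (Fin 2) (Fin 2) ℂ))
            + (((V₁ * V₂ * V₃⁻¹ : Matrix.specialUnitaryGroup (Fin 2) ℂ) : Matrix (Fin 2) (Fin 2) ℂ) * (Complex.I • D₃) * star ((V₁ * V₂ * V₃⁻¹ : Matrix.specialUnitaryGroup (Fin 2) ℂ) : Matrix (Fin 2) (Fin 2) ℂ))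
                * (((V₁ * V₂ * V₃⁻¹ * V₄⁻¹ : Matrix.specialUnitaryGroup (Fin 2) ℂ) : Matrix (Fin 2) (Fin 2) ℂ) * (Complex.I • D₄) * star ((V₁ * V₂ * V₃⁻¹ * V₄⁻¹ : Matrix.specialUnitaryGroup (Fin 2) ℂ) : Matrix (Fin 2) (Fin 2) ℂ)))‖
      ≤ 4 * (‖D₁‖ + ‖D₂‖ + ‖D₃‖ + ‖D₄‖) ^ 3 := by
  set Q : Matrix.specialUnitaryGroup (Fin 2) ℂ := V₁ * V₂ * V₃⁻¹ with hQ
  set P₀ : Matrix.specialUnitaryGroup (Fin 2) ℂ := V₁ * V₂ * V₃⁻¹ * V₄⁻¹ with hP₀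
  set E₁ : Matrix.specialUnitaryGroup (Fin 2) ℂ := expHerm D₁ with hE₁
  set E₂ : Matrix.specialUnitaryGroup (Fin 2) ℂ := expHerm D₂ with hE₂
  set E₃ : Matrix.specialUnitaryGroup (Fin 2) ℂ := expHerm D₃ with hE₃
  set E₄ : Matrix.specialUnitaryGroup (Fin 2) ℂ := expHerm D₄ with hE₄
  set U₂ : Matrix.specialUnitaryGroup (Fin 2) ℂ := V₁ * E₂ * V₁⁻¹ with hU₂
  set U₃ : Matrix.specialUnitaryGroup (Fin 2) ℂ := Q * E₃ * Q⁻¹ with hU₃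
  set U₄ : Matrix.specialUnitaryGroup (Fin 2) ℂ := P₀ * E₄ * P₀⁻¹ with hU₄
  have hgrp : (E₁ * V₁) * (E₂ * V₂) * (E₃ * V₃)⁻¹ * (E₄ * V₄)⁻¹ = (E₁ * U₂ * U₃⁻¹ * U₄⁻¹) * P₀ := by
    rw [hU₂, hU₃, hU₄, hQ, hP₀]; exact plaq_mul_background E₁ E₂ E₃ E₄ V₁ V₂ V₃ V₄
  have hmat : (((E₁ * V₁) * (E₂ * V₂) * (E₃ * V₃)⁻¹ * (E₄ * V₄)⁻¹ : Matrix.specialUnitaryGroup (Fin 2) ℂ) : Matrix (Fin 2) (Fin 2) ℂ) * star (P₀ : Matrix (Fin 2) (Fin 2) ℂ)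
      = (E₁ : Matrix (Fin 2) (Fin 2) ℂ) * (U₂ : Matrix (Fin 2) (Fin 2) ℂ) * star (U₃ : Matrix (Fin 2) (Fin 2) ℂ) * star (U₄ : Matrix (Fin 2) (Fin 2) ℂ) := by
    rw [hgrp]
    have hP : (P₀ : Matrix (Fin 2) (Fin 2) ℂ) * star (P₀ : Matrix (Fin 2) (Fin 2) ℂ) = 1 := Matrix.mem_unitaryGroup_iff.mp P₀.2.1
    simp only [Submonoid.coe_mul]
    rw [show ((U₃⁻¹ : Matrix.specialUnitaryGroup (Fin 2) ℂ) : Matrix (Fin 2) (Fin 2) ℂ) = star (U₃ : Matrix (Fin 2) (Fin 2) ℂ) from rfl, show ((U₄⁻¹ : Matrix.specialUnitaryGroup (Fin 2) ℂ) : Matrix (Fin 2) (Fin 2) ℂ) = star (U₄ : Matrix (Fin 2) (Fin 2) ℂ) from rfl, mul_assoc _ (P₀ : Matrix (Fin 2) (Fin 2) ℂ), hP, mul_one]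
  rw [hmat]
  -- the rows of the four factors
  have cE₁ : (E₁ : Matrix (Fin 2) (Fin 2) ℂ) = exp (Complex.I • D₁) := coe_expHerm hD₁
  have cE₂ : (E₂ : Matrix (Fin 2) (Fin 2) ℂ) = exp (Complex.I • D₂) := coe_expHerm hD₂
  have cE₃ : (E₃ : Matrix (Fin 2) (Fin 2) ℂ) = exp (Complex.I • D₃) := coe_expHerm hD₃
  have cE₄ : (E₄ : Matrix (Fin 2) (Fin 2) ℂ) = exp (Complex.I • D₄) := coe_expHerm hD₄
  obtain ⟨a₁, b₁, c₁⟩ := rows_exp (Complex.I • D₁) (by rw [norm_I_smul]; exact h₁)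
  rw [norm_I_smul, ← cE₁] at a₁ b₁ c₁
  obtain ⟨a₂', b₂', c₂'⟩ := rows_exp (Complex.I • D₂) (by rw [norm_I_smul]; exact h₂)
  rw [norm_I_smul, ← cE₂] at a₂' b₂' c₂'
  obtain ⟨a₂, b₂, c₂⟩ := rows_conj V₁ ((E₂ : Matrix (Fin 2) (Fin 2) ℂ) - 1) (Complex.I • D₂) a₂' b₂' c₂'
  have e₂ : (U₂ : Matrix (Fin 2) (Fin 2) ℂ) - 1 = (V₁ : Matrix (Fin 2) (Fin 2) ℂ) * ((E₂ : Matrix (Fin 2) (Fin 2) ℂ) - 1) * star (V₁ : Matrix (Fin 2) (Fin 2) ℂ) := coe_conj_sub_one V₁ E₂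
  rw [← e₂] at a₂ b₂ c₂
  obtain ⟨a₃', b₃', c₃'⟩ := rows_star_exp hD₃.1 h₃
  rw [← cE₃] at a₃' b₃' c₃'
  obtain ⟨a₃, b₃, c₃⟩ := rows_conj_neg Q (star (E₃ : Matrix (Fin 2) (Fin 2) ℂ) - 1) (Complex.I • D₃) a₃' b₃' c₃'
  have e₃ : star (U₃ : Matrix (Fin 2) (Fin 2) ℂ) - 1 = (Q : Matrix (Fin 2) (Fin 2) ℂ) * (star (E₃ : Matrix (Fin 2) (Fin 2) ℂ) - 1) * star (Q : Matrix (Fin 2) (Fin 2) ℂ) := by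
    rw [← star_coe_conj_sub_one Q E₃, star_sub, star_one]
  rw [← e₃] at a₃ b₃ c₃
  obtain ⟨a₄', b₄', c₄'⟩ := rows_star_exp hD₄.1 h₄
  rw [← cE₄] at a₄' b₄' c₄'
  obtain ⟨a₄, b₄, c₄⟩ := rows_conj_neg P₀ (star (E₄ : Matrix (Fin 2) (Fin 2) ℂ) - 1) (Complex.I • D₄) a₄' b₄' c₄'
  have e₄ : star (U₄ : Matrix (Fin 2) (Fin 2) ℂ) - 1 = (P₀ : Matrix (Fin 2) (Fin 2) ℂ) * (star (E₄ : Matrix (Fin 2) (Fin 2) ℂ) - 1) * star (P₀ : Matrix (Fin 2) (Fin 2) ℂ) := by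
    rw [← star_coe_conj_sub_one P₀ E₄, star_sub, star_one]
  rw [← e₄] at a₄ b₄ c₄
  have n₁ : ‖Complex.I • D₁‖ ≤ ‖D₁‖ := (norm_I_smul D₁).le
  have n₂ : ‖(V₁ : Matrix (Fin 2) (Fin 2) ℂ) * (Complex.I • D₂) * star (V₁ : Matrix (Fin 2) (Fin 2) ℂ)‖ ≤ ‖D₂‖ := by rw [norm_conj_SU, norm_I_smul]
  have n₃ : ‖(Q : Matrix (Fin 2) (Fin 2) ℂ) * (Complex.I • D₃) * star (Q : Matrix (Fin 2) (Fin 2) ℂ)‖ ≤ ‖D₃‖ := by rw [norm_conj_SU, norm_I_smul]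
  exact norm_word4_sub_one_sub_lin_sub_quad_le _ _ _ _ _ _ _ _ (norm_nonneg _) (norm_nonneg _) (norm_nonneg _) (norm_nonneg _) h₄
    n₁ n₂ n₃ a₁ a₂ a₃ a₄ b₁ b₂ b₃ b₄ c₁ c₂ c₃ c₄

end Word

end Summit.QuantumFields.YangMills.Theorems.Prop7Taylor3Word

end
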